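import Summits.QuantumFields.YangMills.Theorems.BalabanUVNodesN12AtRecord13TermPinnedLambda
import Summits.QuantumFields.YangMills.Theorems.BalabanUVNodesN12AtRecord13OfResidualsChi
import Literature.MathematicalPhysics.QuantumFieldTheory.Balaban1983to89.B15Claim189PinsOfHistoryChi

/-!
# BalabanUVNodes ∕ N12 — χ-GENERIC RE-ISSUE (RC-1 «RE-CENTRE THE RECORD», director-ym №462 (B) ∕ №467 (D)) of `…N12AtRecord13TermPinnedLambda` §1: THE [IV] LEAF AT
# `WOfRecord₁₃Chi θL χ λᴧ P`, `θL := Θ.liveRepin₁₃Chi χ`, THE `Λ`-PINNED TERM-PINNED LAYER over `pinRPrime₁₃Chi`, window-free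

Cell `pub-ymgap` (HUMAN RULING D-0062), seat `pub-ymgap-dag-n12-d` g36 (R134 N12 [B15] s2 «knit at the record»).  Sibling of `BalabanUVNodesN12AtRecord13TermPinnedLambda` (this seat).

WHY.  The route's K-cruxes read the RE-CENTRED record since rev 31∕32 ([Ax-2]∕[Ax-3]: `Node00/SmallFieldChi29AxOfRecord`, `Node00/Record13{Ax,Chi,CoPHChi,SepCoPHChi}` — the
Stage-13 chain re-issued GENERIC in the β-slot `χ : ChiSlot F N`; node00-def-Y's `Node00/Record13LiveSelectorChi` — the live re-pin `liveRepin₁₃Chi θ χ` and `Record13` §4c's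
rows in the χ slot).  This seat's kernel σ-closure of N12's junction of record (`N12-SIGMA-CLOSURE-Ax.g36.md`, evidence #2 on 27239; dag-lead g40 WORDS 584 ∕ HANDS-3 addendum:
«N12 road at the re-centred record = dag-n12-d's lane») lists the 13 N12-side statements that read the (2.9) centre, in 8 modules; THIS FILE is the sibling of ONE of them,
re-issuing its Record-13-keyed theorems VERBATIM under the token map σ = (`Θ.liveRepin₁₃ ↦ Θ.liveRepin₁₃Chi … χ`, `gOfRecord₁₃ ↦ gOfRecord₁₃Chi … χ`, `reprTOfRecord₁₃ ↦
reprTOfRecord₁₃Chi … χ`, `EOfRecord₁₃ ↦ EOfRecord₁₃Chi … χ`, `WOfRecord₁₃ ↦ WOfRecord₁₃Chi … χ`, `Provisos₁₃ ↦ Provisos₁₃Chi … χ`, `betaOfRecord₁₃ ↦ betaOfRecord₁₃Chi … χ`,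
`pinRPrime₁₃ ↦ pinRPrime₁₃Chi … χ`, `N0OfRecord₁₃ ↦ N0OfRecord₁₃Chi … χ`; K0a faces `↦ …Chi_…`), same short names in the sibling namespace (dag-n11-d's convention; consumers
switch by namespace).  dag-n11-e's three live-selector wrappers (`ppSel_succ_idem_of_liveSel`, `liveRepin₁₃_liveSel`, `rstep₁₃_of_liveSel_of_hasResiduals`) are NOT
restated: their one-line bodies over the history-generic NODE 00 lemmas (`ppSelLiveOfRecord_succ_idem`, `rfl`, `rstep₁₃_of_localBg_liveSel_chi`) are inlined.  At
`χ := chiβOfRecord₁₃ Θ` every theorem IS the parent's (definitionally, [Ax-3b]'s `rfl` receipts); at `χ := chiβOfRecord₁₃Ax Θ` it is what the re-centred record's N12 road reads.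
Nothing of record edited (body-freeze №460 (2)).

HONEST FRAMING.  Kernel bookkeeping BY NAME, χ-generic (definitions over the β-slot parameter + the parents' proofs verbatim); the displayed rows of the parent stay DISPLAYED;
nothing of Bałaban's asserted; N12 NOT discharged; K0ᴬ ∕ K1ᴬ ∕ K3ᴬ OPEN; counts unmoved; one finite 𝕋⁴ programme at fixed `ε = L^{-K}` — NOT continuum ∕ ℝ⁴ ∕ OS; NOT the
Yang–Mills mass gap (Clay).  THEOREMS ONLY (0 `def`, 0 `instance`, 0 `sorry`).  Filed `--kind proof --supports stmt-QuantumFields-27239 --as helper` (K1ᴬ, route rev 31∕32).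
Sources (bookkeeping only): [Balaban1989LargeFieldI] (0.2)–(0.6) pp.176–177, Prop. 1 (1.78) p.194, (1.80) p.195, (1.89) p.198, (1.99)–(1.102) pp.200–201;
[Balaban1988Convergent] (2.18) p.257, (3.22)–(3.25) pp.269–270; [Balaban1987RG1] (0.17)–(0.20) pp.255–256, (2.9) p.266 (the cut-off's centre).
-/

noncomputable section

open scoped BigOperators ENNReal
open MeasureTheory
open scoped Matrix.Norms.L2Operator

namespace Summit.QuantumFields.YangMills.BalabanUVNodes.N12AtRecord13TermPinnedLambdaChi

open Literature.MathematicalPhysics.QuantumFieldTheory.Balaban1983to89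
open Literature.MathematicalPhysics.QuantumFieldTheory.Balaban1983to89.T4Continuum (T4Family)
open Literature.MathematicalPhysics.QuantumFieldTheory.Balaban1983to89.DagBinding (PrintedCarriers15 B15Leaf)
open Literature.MathematicalPhysics.QuantumFieldTheory.Balaban1983to89.Node00
open B15Claim189Assembly (Setting189 new189 chiPP dom half)
open B15 (Prop1Printed Ineq180)
open B15.BasicStep (Claim189)
open B15.PrelimIntegrations (Ineq191 Ineq195)
open B15Chi124DetSets (E124)
open B15DeterminingSets (MSField)
open B14DomainGeom (Pt)
open B8Eq17ClassAkV1 (plaqsOf)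
open GaugeGroup (dist1)
open GaugeField (plaqHol)
open B15Claim189PrintedConditions (omegaOfChain)
open B15Claim189PinsOfHistory (sitOfHist N0OfRecord₁₃ D189OfHist)
open B15Claim189LambdaPin (enlD h189_pinD189ΛH_of_h180_of_flow h189_pinD189ΛH₁₃_of_h180_of_inInterval)
open FlowStep (prefixOf BetaUpperH)
open B14FlowStep (SmallnessFor)
open Summit.QuantumFields.YangMills.BalabanUVNodes.N12AtRecord13TermPinned (new189_pinAllTH_liveRepin₁₃_one_zero)
open Summit.QuantumFields.YangMills.BalabanUVNodes.N12AtRecord13OfResidualsChi (b15Leaf_WOfRecord₁₃_liveRepin₁₃_of_massLive_of_hasResiduals)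
open B15Claim189PinsOfHistory (N0OfRecord₁₃Chi)

variable {N : ℕ} [NeZero N] {F : T4Family}

section LeafChi
variable (Θ : Stage13Params F N) (χ : ChiSlot F N) (lam : ResidW F N) (σ : ∀ P : B12.RunParams, Sit189 F N P.K)
  (s : ∀ P : B12.RunParams, SeqOfRecord F Θ.ν Θ.τ9.M (gOfRecord₁₃Chi F N (Θ.liveRepin₁₃Chi F N χ) χ P) P.K (lam.kSel P + 1)) (Nm : B12.RunParams → ℕ) (p₁ : ℕ)

/-- **★★ THE [IV] LEAF AT `WOfRecord₁₃ θL λᴧ P` (`θL := Θ.liveRepin₁₃`, `Θ` CARRYING K0b's RESIDUALS) FOR A RUN WITH `kSel P < K` — WINDOW-FREE, NO `Provisos₁₃`, NO (1.89) DISPLAY, NO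
LOCATED-GEOMETRY BINDER** (12F's `…pinAllGeom_N0…` row with `hgeom`, `enl`, `henl` GONE): 12E's `b15Leaf_WOfRecord₁₃_liveRepin₁₃_of_massLive_of_hasResiduals` at the `Λ`-pinned term-pinned layer
`λᴧ = (λ.pinRPrime₁₃Chi θL χ).pinD189ΛH …` (pin equation `rfl`) with the `h189` slot SUPPLIED BY NAME by dag-n12-e module 16 v1.1's `h189_pinD189ΛH_of_h180_of_flow`.  Stated with a defining equation
`hD` for the letters (instantiate `rfl`).  DISPLAYED:
positive mass of the LIVE pre-𝐑 terms at level `kSel P + 1`, Prop. 1 at `λ.LF P`, `1 < (log g_{k′}⁻²)^r`, `N₀ ≤ N P`, `N₀ ≤ k′`, the residual numerics and signs, print's two p. 200 conditions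
(`hN₀ hMl`), `0 < σ.sh`, `0 < M`, the flow inputs along the ₁₃ history (`hε0 hε1 hflow`), ONE STEP of monotone couplings (`hgpos hgstep hgle`), `Λ ≠ ∅` (`hΛ`), the four ℍ-leaves (`L91h L95 L91 L97`)
and (1.80) (`L80`). [cite: Balaban1989LargeFieldI, (0.2)–(0.6) p.176, p.176 ll.14–16, (1.73) p.192, Prop. 1 (1.78) p.194, (1.80) p.195, (1.10)–(1.11) p.179, (1.88)–(1.90) pp.197–198, pp.199–201; Balaban1988Convergent, (2.1) p.254, (2.5)–(2.8) pp.255–256, (2.17) p.257, (3.16) p.268, (3.22)–(3.25) pp.269–270; Balaban1987RG1, (0.20) p.256] -/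
theorem b15Leaf_WOfRecord₁₃_pinAllΛ_N0_liveRepin₁₃_of_massLive_of_hasResiduals_of_flow (hres : Θ.HasResidualsOfRecord F N)
    {P : B12.RunParams} (hK : lam.kSel P < P.K) (hsh : 0 < (σ P).sh) (hM : 0 < Θ.τ9.M)
    {D : Setting189 (F.P P.K) (SU N) (MSField (F.P P.K) (SU N) × ((j : ℕ) → VecField (F.P P.K) j (EuclideanSpace ℝ (Fin (N ^ 2 - 1))))) (Pt (F.P P.K).d)}
    (hD : D = ((lam.pinRPrime₁₃Chi (Θ.liveRepin₁₃Chi F N χ) χ).pinD189ΛH (Θ.liveRepin₁₃Chi F N χ).ν (Θ.liveRepin₁₃Chi F N χ).A₁ (Θ.liveRepin₁₃Chi F N χ).τ9.M (gOfRecord₁₃Chi F N (Θ.liveRepin₁₃Chi F N χ) χ) σ s Nm p₁).D189 P)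
    (hmassLive : ∀ a, LiveSeq F N Θ.ν Θ.τ9 P (gOfRecord₁₃Chi F N (Θ.liveRepin₁₃Chi F N χ) χ P) (lam.kSel P + 1)
        (slotsTOfRecord F N Θ.ν Θ.τ9 (EOfRecord₁₃Chi F N (Θ.liveRepin₁₃Chi F N χ) χ) (wOfRecord₉ F N (Θ.liveRepin₁₃Chi F N χ).toStage9Params)
          (Θ.liveRepin₁₃Chi F N χ).ppSel P (gOfRecord₁₃Chi F N (Θ.liveRepin₁₃Chi F N χ) χ P) (lam.kSel P + 1)) a →
      0 < ∫ V, rterm (reprTOfRecord₁₃Chi F N (Θ.liveRepin₁₃Chi F N χ) χ P (lam.kSel P)) a V ∂(fieldMeasure (F.P P.K) (lam.kSel P + 1) (SU N)))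
    (hP1 : Prop1Printed (lam.LF P))
    (hlog : 1 < (Real.log (gOfRecord₁₃Chi F N (Θ.liveRepin₁₃Chi F N χ) χ P (lam.kSel P + 1) ^ 2)⁻¹) ^ Θ.ν.r)
    (hNN : N0OfRecord₁₃Chi (Θ.liveRepin₁₃Chi F N χ) χ P (lam.kSel P + 1) ≤ Nm P) (hNk : N0OfRecord₁₃Chi (Θ.liveRepin₁₃Chi F N χ) χ P (lam.kSel P + 1) ≤ lam.kSel P + 1)
    (hβ0 : 0 ≤ (σ P).β) (hβ : (σ P).β ≤ 1 / 4) (hL₀ : 2 ≤ (σ P).L₀) (hL₀L : (σ P).L₀ ^ 2 ≤ ((F.P P.K).L : ℝ))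
    (hB : 0 ≤ (σ P).O1 * (σ P).B₃ * (σ P).B₅) (hδ : 0 ≤ (σ P).δ)
    (hN₀ : (2 + (121 / 120) ^ 2 * ((σ P).O1 * (σ P).B₃ * (σ P).B₅ * (Θ.τ9.M : ℝ) ^ 5)) *
      ((((σ P).L₀ ^ 2) ^ (N0OfRecord₁₃Chi (Θ.liveRepin₁₃Chi F N χ) χ P (lam.kSel P + 1) - 1))⁻¹) ≤ 1 / 4)
    (hMl : (121 / 120) ^ 2 * ((σ P).O1 * (σ P).B₃ * (σ P).B₅ * (Θ.τ9.M : ℝ) ^ 5) * Real.exp (-(4 * (σ P).δ * (Θ.τ9.M : ℝ))) ≤ 1 / 12)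
    (hε0 : ∀ i, lam.kSel P + 1 - Nm P ≤ i → i ≤ lam.kSel P + 1 → 0 ≤ epsOfRecord Θ.ν (gOfRecord₁₃Chi F N (Θ.liveRepin₁₃Chi F N χ) χ P) i)
    (hε1 : ∀ i, lam.kSel P + 1 - Nm P ≤ i → i ≤ lam.kSel P + 1 → epsOfRecord Θ.ν (gOfRecord₁₃Chi F N (Θ.liveRepin₁₃Chi F N χ) χ P) i ≤ 1 / 10)
    {β₀ : ℝ} (hβ₀0 : 0 ≤ β₀) (hβ₀ : β₀ ≤ 1 / 2)
    (hflow : ∀ j, lam.kSel P + 1 - Nm P ≤ j → j < lam.kSel P + 1 → epsOfRecord Θ.ν (gOfRecord₁₃Chi F N (Θ.liveRepin₁₃Chi F N χ) χ P) (lam.kSel P + 1)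
      ≤ (1 + β₀) * Real.sqrt ((lam.kSel P + 1 - j : ℕ) : ℝ) * epsOfRecord Θ.ν (gOfRecord₁₃Chi F N (Θ.liveRepin₁₃Chi F N χ) χ P) j)
    -- the `N₀`-equation's one step of monotone couplings, and `Λ ≠ ∅` (a non-trivial 𝐑-step)
    (hgpos : 0 < (gOfRecord₁₃Chi F N (Θ.liveRepin₁₃Chi F N χ) χ P) (lam.kSel P + 1 + 1 - (N0OfRecord₁₃Chi (Θ.liveRepin₁₃Chi F N χ) χ P (lam.kSel P + 1))))
    (hgstep : (gOfRecord₁₃Chi F N (Θ.liveRepin₁₃Chi F N χ) χ P) (lam.kSel P + 1 + 1 - (N0OfRecord₁₃Chi (Θ.liveRepin₁₃Chi F N χ) χ P (lam.kSel P + 1))) ≤ (gOfRecord₁₃Chi F N (Θ.liveRepin₁₃Chi F N χ) χ P) (lam.kSel P + 1 + 2 - (N0OfRecord₁₃Chi (Θ.liveRepin₁₃Chi F N χ) χ P (lam.kSel P + 1))))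
    (hgle : (gOfRecord₁₃Chi F N (Θ.liveRepin₁₃Chi F N χ) χ P) (lam.kSel P + 1 + 2 - (N0OfRecord₁₃Chi (Θ.liveRepin₁₃Chi F N χ) χ P (lam.kSel P + 1))) ≤ 1)
    (hΛ : (((enlD F Θ.ν Θ.τ9.M P (gOfRecord₁₃Chi F N (Θ.liveRepin₁₃Chi F N χ) χ P)) 4 (lam.kSel P + 1 + 1 - (N0OfRecord₁₃Chi (Θ.liveRepin₁₃Chi F N χ) χ P (lam.kSel P + 1)))
        (omegaOfChain (s P) (lam.kSel P + 1 + 1 - (N0OfRecord₁₃Chi (Θ.liveRepin₁₃Chi F N χ) χ P (lam.kSel P + 1)))))ᶜ ∩ (σ P).Z).Nonempty)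
    (L91h : ∀ U, new189 D U → ∀ p ∈ plaqsOf (half D),
      Ineq191 (dist1 (plaqHol (D.Upp U) p)) (D.devV'' U p) D.α ((D.L ^ D.h)⁻¹) (D.ε D.h) (E124 D.ε D.L D.η D.k D.h))
    (L95 : ∀ U, new189 D U → ∀ p ∈ plaqsOf (half D),
      Ineq195 (D.devV'' U p) (dist1 (plaqHol (D.Uhalf U (D.boxOf p)) p)) D.α ((D.L ^ D.h)⁻¹) (D.ε D.h) (E124 D.ε D.L D.η D.k D.h))
    (L91 : ∀ U, new189 D U → ∀ j, D.h ≤ j → j ≤ D.k → ∀ p ∈ plaqsOf (dom D j),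
      Ineq191 (dist1 (plaqHol (D.Upp U) p)) (D.dev97 U p) D.α ((D.L ^ j)⁻¹) (D.ε j) (E124 D.ε D.L D.η D.k j))
    (L97 : ∀ U, new189 D U → ∀ j, D.h ≤ j → j ≤ D.k → ∀ p ∈ plaqsOf (dom D j),
      Ineq191 (D.dev97 U p) (D.dev0 U p) D.α ((D.L ^ j)⁻¹) (D.ε j) (E124 D.ε D.L D.η D.k j))
    (L80 : ∀ U, new189 D U → ∀ j, D.h ≤ j → j ≤ D.k → ∀ p ∈ plaqsOf (dom D j),
      Ineq180 (D.dev0 U p) (D.ε D.k) D.η D.B₃ D.B₅ D.M D.δ (D.dist p) D.O1) :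
    B15Leaf (WOfRecord₁₃Chi F N (Θ.liveRepin₁₃Chi F N χ) χ
      ((lam.pinRPrime₁₃Chi (Θ.liveRepin₁₃Chi F N χ) χ).pinD189ΛH (Θ.liveRepin₁₃Chi F N χ).ν (Θ.liveRepin₁₃Chi F N χ).A₁ (Θ.liveRepin₁₃Chi F N χ).τ9.M (gOfRecord₁₃Chi F N (Θ.liveRepin₁₃Chi F N χ) χ) σ s Nm p₁) P) := by
  subst hD
  exact b15Leaf_WOfRecord₁₃_liveRepin₁₃_of_massLive_of_hasResiduals Θ χ _ hres hK rfl hmassLive hP1 (fun U hU i hi hik q hq => L80 U hU i hi hik q hq)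
    (h189_pinD189ΛH_of_h180_of_flow P hsh hM hlog hNN hNk hβ0 hβ hL₀ hL₀L hB hδ hN₀ hMl hε0 hε1 hβ₀0 hβ₀ hflow hgpos hgstep hgle hΛ L91h L95 L91 L97 L80)

end LeafChi

end Summit.QuantumFields.YangMills.BalabanUVNodes.N12AtRecord13TermPinnedLambdaChi

end
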